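import Summits.ABC.IUTFork.Repair.CandMochizuki32
import Summits.ABC.IUTFork.Cor312TwoPlacePins
import HarnessLib

/-!
# REPAIR branch B1 / CandMochizuki32TwoPlace — the three readings of [IUTchIII] Rmk 3.12.2 (ii) (f^itw)/(f^toy)
# (`Repair.CandMochizuki32.H / H' / H''`, rows RP-M32a/b/c) at the TWO-PLACE bed `2PL(depth)` (PROFILE column)

PROOF-ONLY companion (0 definitions, 0 `Prop` facts; class `Mochizuki`, sub-cell B1, seat abc-iut-rp-m3 gen 2; rung LADDER-ABC:A2.RP ⊆
A2.B; REPAIR-SPEC v0.4 §3 PROFILE, engine request E4). Consumes BY NAME: the candidate file `Repair/CandMochizuki32.lean` (p427902) and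
abc-iut-rp-m4's two-place bed `Cor312TwoPlaceSetting` / `Cor312TwoPlacePins` (`twoSetting p c depth` over `twoIndex`: two rational places,
both bad, `l⋆ = 2`; honest q-images `B_1`; Θ-images `B_{j²−d(v)}` with the inflation profile `depth = (0, 3)` — deep place `0`,
compensating place `1`; pins via `rho2`; the typed Corollary's Statement HOLDS there by COMPENSATION ACROSS PLACES while the local portion
fails at the place `0`, `two_place_pinned_witness`). rp-cx's `Repair/EvalTwoPlaceProfile` (p435182) gives the 2PL column for the
interface rows (Statement ✓ · GVT ✓ · X04a ✗ · VT ✗ · Licence ✗); this file adds the M32 rows.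

WHAT IS PROVED (every cell at `twoSetting p c depth`, any prime `p`, any `c`; the pinned reading `(rho2, qDatum)` where pins are needed):
* `not_H''_twoPlace` — **RP-M32c (HULL reading) FAILS** for every `ρ qK` (the (xi-f) licence fails at the deep place: `B_1 ⊄ B_4` at label
  `2`, rp-m4 `two_not_licence`; `H'' ⟹ Licence`);
* `not_H_twoPlace` — **RP-M32a (REGION reading) FAILS** for every `ρ qK` (`H ⟹ H''`);
* `not_H'_twoPlace` — **RP-M32b (VOLUME reading) FAILS** for every `ρ qK` and every `c ≠ 0`: at the deep place `0`, label `2`, the unique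
  possible image is `B_4` of log-volume `−4c` while the q-pilot's local log-volume is `μ(B_1) = −c`;
* `twoPlace_profile` — packaged at `c = log p`: typed Thm 3.11 ∧ BridgeHyps ∧ `|log(q)| > 0` ∧ PinnedRegions3 ∧ **Statement ✓** ∧
  `¬ H ∧ ¬ H' ∧ ¬ H''` ∧ ¬ Licence ∧ ¬ S.

READING FOR THE CENSUS (neutral). On the first MULTI-PLACE bed of record all three readings of «the q-intertwining … a special case of the
Θ-intertwining … up to suitable indeterminacies» FAIL while the typed Corollary HOLDS — by compensation across places, not packetwise.
This is the multi-place form of the flag the census carries on every level-H row («packetwise — stronger than the Statement's averaged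
bound», REPAIR-SPEC §3 / P5): the hull reading RP-M32c (FAITHFUL ×2) is a PER-PACKET hypothesis; the printed conclusion is a
procession-normalised SUM over places and labels. (One-place analogue already in the tree: LS `d = 2`, Statement ✓ ∧ ¬H'',
`H''_shell_iff` / `shell_statement_iff`.) Nothing here decides which reading print intends. [claim: Mochizuki2012, status: disputed] for
the quoted sentence (kurims `paper:url-4b091feeb646` Rmk 3.12.2 (ii) p. 189 l. 54–62; (f^toy) p. 191 l. 13–33). HONEST FRAMING: locates /
conditionally verifies; nothing here asserts that abc or [IUTchIII] Cor 3.12 is proved or refuted; no side taken on any author;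
candidates are hypotheses; typed ≠ proved; instantiated ≠ endorsed; the two-place bed is a model of OUR typed interface.
-/

noncomputable section

open Set

namespace Summit.ABC.IUTFork.Repair.CandMochizuki32TwoPlace

open Thm311 Cor312 Cor312Vol Cor312Vol.NaiveProv Cor312Vol.PinnedWitness Cor312Vol.TwoPlace Literature.IUT.LogThetaLattice
  Repair.CandMochizuki32

variable (p : ℕ) [hp : Fact p.Prime] (c : ℝ)
  (ρ : (∀ v : twoIndex.V, v ∈ twoIndex.Vbad → Set ((signShells twoIndex).StarPacket v)) →
    ∀ (j : twoIndex.Label) (vQ : twoIndex.VQ), Set ((signShells twoIndex).Packet j vQ))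
  (qK : ∀ v : twoIndex.V, v ∈ twoIndex.Vbad → Set ((signShells twoIndex).StarPacket v))

/-- **RP-M32c FAILS at the two-place bed** (every `p`, `c`, `ρ`, `qK`): the (xi-f) licence fails at the deep place (rp-m4 `two_not_licence`)
and `H'' ⟹ Licence` (`licence_of_H''`). [folklore] -/
theorem not_H''_twoPlace : ¬ H'' (twoFull p c).toLatticeSituation (twoSetting p c depth) ρ qK := fun h =>
  two_not_licence p c (licence_of_H'' _ _ ρ qK h)

/-- **RP-M32a FAILS at the two-place bed** (`H ⟹ H''`). [folklore] -/
theorem not_H_twoPlace : ¬ H (twoFull p c).toLatticeSituation (twoSetting p c depth) ρ qK := fun h =>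
  not_H''_twoPlace p c ρ qK (H''_of_H _ _ ρ qK h)

/-- **RP-M32b FAILS at the two-place bed** for every `c ≠ 0` (every `ρ`, `qK`): at the deep place `v = 0` and the label `j = 2` the unique
possible image of the Θ-pilot is the honest `B_4` (`two_possibleImages`, `depth 0 = 0`), of log-volume `−4c` (`volW_pBall`), while the
q-pilot's local log-volume is `−c` (`two_qLocal`). [folklore] -/
theorem not_H'_twoPlace (hc : c ≠ 0) : ¬ H' (twoFull p c).toLatticeSituation (twoSetting p c depth) ρ qK := by
  intro h
  obtain ⟨U, hU, hvol⟩ := h ⟨1, by decide⟩ 0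
  rw [two_possibleImages, Set.mem_singleton_iff] at hU
  subst hU
  rw [two_qLocal] at hvol
  have h4 : (jsq (T := twoIndex) (Setting.labelSucc (⟨1, by decide⟩ : Fin twoIndex.lstar)) : ℤ) - (depth 0 : ℤ) = 4 := by decide
  have hv : ((situationW p (fun _ => c) (thetaVec1 (T := twoIndex) p)).D (twoSetting p c depth).n).logvol _ (0 : twoIndex.VQ)
      (pBall p (Setting.labelSucc (T := twoIndex) (⟨1, by decide⟩ : Fin twoIndex.lstar)) (0 : twoIndex.VQ)
        (jsq (T := twoIndex) (Setting.labelSucc (⟨1, by decide⟩ : Fin twoIndex.lstar)) - depth 0)) = -(4 : ℝ) * c := by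
    show volW p (fun _ => c) _ (0 : twoIndex.VQ) (pBall p _ (0 : twoIndex.VQ) _) = _
    rw [volW_pBall, h4]
    push_cast
    ring
  have hc4 : -c = -(4 : ℝ) * c := hvol.trans hv
  exact hc (by linarith)

/-- **2PL column for RP-M32a/b/c, packaged at `c = log p`** (rp-m4's pinned two-place witness + the three cells): typed Thm 3.11 ∧
BridgeHyps ∧ `|log(q)| > 0` ∧ PinnedRegions3 for `(rho2, qDatum)`; the typed Corollary's Statement HOLDS (compensation across the two
places); the REGION, VOLUME and HULL readings of Rmk 3.12.2 (ii) all FAIL; the (xi-f) Licence and the residual S FAIL. [folklore] -/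
theorem twoPlace_profile :
    (twoFull p (Real.log p)).Statement ∧ BridgeHyps (twoSetting p (Real.log p) depth) ∧ (twoSetting p (Real.log p) depth).AbsLogQPos ∧
      PinnedRegions3 (twoFull p (Real.log p)).toLatticeSituation (twoSetting p (Real.log p) depth) (rho2 p depth)
        (qDatum p (0 : twoIndex.V) trivial (Real.log p)) ∧
      Summit.ABC.IUTFork.Cor312.Setting.Statement (twoSetting p (Real.log p) depth) ∧
      ¬ H (twoFull p (Real.log p)).toLatticeSituation (twoSetting p (Real.log p) depth) (rho2 p depth)
          (qDatum p (0 : twoIndex.V) trivial (Real.log p)) ∧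
      ¬ H' (twoFull p (Real.log p)).toLatticeSituation (twoSetting p (Real.log p) depth) (rho2 p depth)
          (qDatum p (0 : twoIndex.V) trivial (Real.log p)) ∧
      ¬ H'' (twoFull p (Real.log p)).toLatticeSituation (twoSetting p (Real.log p) depth) (rho2 p depth)
          (qDatum p (0 : twoIndex.V) trivial (Real.log p)) ∧
      ¬ Thm311ToCor312.Licence (twoSetting p (Real.log p) depth) ∧
      ¬ PilotKummerIndRelated (twoFull p (Real.log p)).toLatticeSituation (twoSetting p (Real.log p) depth) (rho2 p depth)
          (qDatum p (0 : twoIndex.V) trivial (Real.log p)) :=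
  have hc : 0 < Real.log p := Real.log_pos (by exact_mod_cast hp.out.one_lt)
  have hw := two_place_pinned_witness p
  ⟨hw.1, hw.2.1, hw.2.2.1, hw.2.2.2.1, hw.2.2.2.2.1, not_H_twoPlace p _ _ _, not_H'_twoPlace p _ _ _ hc.ne', not_H''_twoPlace p _ _ _,
    hw.2.2.2.2.2.2.1, hw.2.2.2.2.2.2.2.2.2⟩

end Summit.ABC.IUTFork.Repair.CandMochizuki32TwoPlace

end
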